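import Mathlib
import HarnessLib
import Literature.Computability.AlgebraicComplexity.ExteriorTensor
import Literature.Computability.AlgebraicComplexity.PrattTripartitionBoundsProofs
import Literature.Computability.AlgebraicComplexity.MatMulRankLowerBoundsBlaserProofs
import Literature.FieldTheory.AlgClosed.PadicAlgClEquivComplex
import Summits.MatrixMultiplication.MatrixMultiplication.Theses.HenselReesLifting

/-!
# Crux `ExteriorExponentOne` (stmt-MatrixMultiplication-3850) — `Lines/birth.lean`, the BC3 birth skeleton

Route `HenselReesLifting` (route-MatrixMultiplication-HenselReesLifting; deciding theorem
`closes : ExteriorExponentOne → CliffordReduction → CliffordMatrixModel → MatrixMultiplication`). The crux is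
`e_Λ = 1`: for every `ε > 0` and all large `n`, the asymptotic rank of the exterior-algebra structure tensor
`T_{Λ_n}` (the route's inlined lambda on `Finset (Fin n)`, which is `exteriorTensor ℂ n` of
`Literature/…/ExteriorTensor.lean` by `rfl`, `exteriorTensor_eq`) is at most `2^((1+ε)n)`.

THE LINE = FINITE EXTERIOR DESIGNS VIA GRADED SUB-MULTIPLICATIVITY. `Λ_{k+l} = Λ_k ⊗̂ Λ_l` is a GRADED
tensor product (Koszul sign rule): under the order-preserving splitting `S = S₁ ⊔ S₂` of a subset of
`{0,…,k+l-1}` into its parts below / from `k`, the route's sign decomposes as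
`inv(S,T) = inv(S₁,T₁) + inv(S₂,T₂) + |S₂|·|T₁|` (every element of `T₁` lies below every element of `S₂`,
none of `T₂` below `S₁`), so `T_{Λ_{k+l}} ≅ (T_{Λ_k} ⊠ T_{Λ_l}) · (−1)^{|S₂||T₁|}` — a Kronecker product twisted
by a bicharacter of the parities of ONE leg of each factor. Splitting the `T`-leg functionals of a
decomposition of the first factor by parity absorbs the twist at the cost of a factor `2`:
`R(T_{Λ_{k+l}}) ≤ 2·R(T_{Λ_k})·R(T_{Λ_l})`, i.e. `b_n := 2·R(T_{Λ_n})` is sub-multiplicative in `n`. Hence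
(Fekete-type bookkeeping, done sorry-free below) ONE block size `k` with `2·R(T_{Λ_k}) ≤ 2^((1+δ)k)` gives
`R(T_{Λ_n}) ≤ 2^((1+δ)n + 3k)` for all `n ≥ k`, and `R̃ ≤ R`: the asymptotic, all-large-`n` crux follows from a
statement about ONE explicit finite tensor per `δ` — exactly as `ω ≤ log_k R(⟨k,k,k⟩)` turns `ω` into a
family of finite targets. The three registered stubs:

* `stub_exteriorSplitting` — the Koszul splitting at rank level: `R(T_{Λ_{k+l}})` equals the rank of the
  twisted Kronecker product of `T_{Λ_k}` and `T_{Λ_l}` on `Finset (Fin k) × Finset (Fin l)` (a coordinate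
  relabelling `Finset (Fin (k+l)) ≃ Finset (Fin k) × Finset (Fin l)` plus the sign identity above;
  `tensorRank_reindex` is in tree). Provable now, size M; true over every commutative ring.
* `stub_twistedKroneckerRank` — the general tool: for tensors `A`, `B` over a commutative ring and parity
  weights `σ` on the second leg of `B`, `τ` on the third leg of `A`, the Kronecker product twisted by
  `(−1)^{σ(b')·τ(c)}` has rank `≤ 2·R(A)·R(B)` (split each third-leg functional `v_i` of an optimal
  decomposition of `A` into its `τ`-even and `τ`-odd parts; on the `τ ≡ p` part the twist is the diagonal
  rescaling `b' ↦ (−1)^{p·σ(b')}` of the second leg of `B`). Provable now, size M; the same lemma serves the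
  Clifford side of the route (`Cl_{k+l} = Cl_k ⊗̂ Cl_l`, same sign rule for `cliffordTensor`).
* `stub_finiteExteriorDesign` — THE LOAD-BEARING OPEN STUB (XL / open): for every `δ > 0` SOME block size
  `k ≥ 1` has `2·R(T_{Λ_k}) ≤ 2^((1+δ)k)` over `ℂ`. It is a TRANSFER of the crux to a finitary form
  `C⁺`. Why easier / what it exposes: one explicit `2^k × 2^k × 2^k` tensor with `0, ±1` entries per `δ`,
  open to (i) computer search + exact reconstruction (the method behind every small matrix-multiplication
  rank: flip graphs arXiv:2212.01175, SAT/numerical schemes), (ii) the route's own 2-adic Hensel lifting AT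
  ONE FINITE LEVEL — no Kronecker powers `N`, no uniformity in `n` (kernel-checked below:
  `finiteExteriorDesign_of_twoAdic`, an integral design over the valuation ring `Z̄_2` of `Q̄_2` transports
  to `ℂ` along `Z̄_2 ⊂ Q̄_2 ≃+* ℂ`), (iii) explicit graded constructions. Frame: `R(T_{Λ_k}) ≥ 2·2^k − 1`
  (Alder–Strassen, `Λ_k` local; tree fact `AlderStrassen1981_rank`) forces `δ·k ≥ 2`; trivially
  `R ≤ 3^k`; via Clifford `2^((ω/2)k + o(k))`. Why it might fail: the RANK exponent
  `e_R := lim_k log₂R(T_{Λ_k})/k` (exists by Fekete and stubs 1–2) might exceed `1` — but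
  `e_R = e_bR = e_Λ` (border rank: Bini + graded powers; asymptotic rank: the same parity splitting applied
  to `T_{Λ_n}^{⊠N}` with the `F_2^N`-grading gives `R(T_{Λ_{nN}}) ≤ 2^N·R(T_{Λ_n}^{⊠N})`, whence
  `e_R ≤ 1/n + log₂R̃(T_{Λ_n})/n`), so stub 3 is EQUIVALENT to the crux — it fails iff the crux fails — and it
  is NOT cheaply equivalent (probes below; crux ⇒ stub 3 needs the `F_2^N`-graded splitting and Fekete,
  stub 3 ⇒ crux needs stubs 1–2 and the bookkeeping of `ExteriorExponentOne_of_submultiplicative`).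
* `ExteriorExponentOne_of_submultiplicative` / `ExteriorExponentOne_of_stubs` — sorry-free compositions with
  EXPLICIT hypotheses (conclusion = the crux statement over `exteriorTensor ℂ n`, definitionally the route's):
  Euclidean division `n = kq + j`, `b_n ≤ b_k^q · b_j ≤ 2^((1+δ)kq) · 2^(3j+1)` (`R ≤ 8^j` for a `2^j`-format
  tensor, `tensorRank_le_card`), real-exponent comparison with `δ = ε/2` and `n ≥ 6k/ε`, then
  `asymptoticRank_le_tensorRank`.
* `ExteriorExponentOne_of : ExteriorExponentOne` — THE skeleton theorem: the crux BY NAME from the three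
  declared stubs (`sorry` occurs ONLY inside the three `stub_*`).

Honest status. Stubs 1–2 are theorems (characteristic-free linear algebra, M each); stub 3 carries the whole
open difficulty and is equivalent to the crux (above). What the skeleton adds to the route: the route header
records "no upper bound below `2^{ωn/2}` is known" and wires the crux only through `HenselLiftExterior`
(2-adic lifts of Kronecker powers `T_{Λ_n}^{⊠N}` for all large `n`); the graded sub-multiplicativity shows
that a lift — or any construction — for ONE `T_{Λ_k}` below `2^((1+δ)k)/2` already gives `e_Λ ≤ 1+δ`, and
that `e_Λ < ω/2` (wedge products strictly easier than matrix products, the route's "EITHER answer is new")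
is witnessed by a single finite `k` with `2R(T_{Λ_k}) < 2^(1.185k)`. Disproof used: none exists —
`ledger crux ls stmt-MatrixMultiplication-3850` showed no workfiles (no `Disproof.lean`, no `Negative/`) on
2026-08-17, and `ledger negatives --problem MatrixMultiplication` (7 refuted statements, 2026-08-17) has none
about exterior / Clifford / truncated-polynomial structure tensors or about ranks of explicit algebra
tensors (nearest in kind: `DesignFlatteningSeparableDesignsMultiplicative_refuted`, stmt-8036, a
multiplicativity claim for Kronecker powers of CW-type designs — stub 2 here is a one-sided INEQUALITY with
an explicit defect `2`, proved by an explicit decomposition, not a multiplicativity identity). Kills: a proof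
that `e_R > 1` (an exponential-rate rank lower bound `R(T_{Λ_k}) ≥ 2^((1+c)k)`, far beyond the linear
Alder–Strassen / substitution-method bounds) refutes stub 3 AND the crux; `ω(ℂ) > 2` does not refute this
crux alone (it refutes `ExteriorExponentOne ∧ CliffordReduction`).

BC3 record (raw outputs in the seat's NOTES.md `## birth-certificate`): `lean check --json` rc 0, errors [],
warnings = 3 × "declaration uses `sorry`" (the three `stub_*`), sorries 3 = stubs 3, zero elsewhere
(`ExteriorExponentOne_of_stubs`, `ExteriorExponentOne_of_submultiplicative`,
`gradedSubmultiplicativity_of_stubs`, `tensorRank_exteriorTensor_map_le`, `finiteExteriorDesign_of_twoAdic`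
closed); probes `stub → ExteriorExponentOne` and `stub → MatrixMultiplication` for each stub by the battery
`exact? | simpa | (intro h; simpa using h) | (intro h; simpa [C] using h) | (intro h; unfold C; simpa using h) |
aesop (terminal) | (intro h; unfold C; aesop (terminal))`, importing the route file and `ExteriorTensor` but
NOT this skeleton: 6/6 FAIL (and 2/2 FAIL for the derived `gradedSubmultiplicativity`); converses
`ExteriorExponentOne → stub`: 3/3 FAIL; `stub` alone by `exact? | simp | aesop`: 3/3 FAIL (no stub is a
library/tree theorem by name; where `exact?` hit the heartbeat cap the rest of the battery was re-run
without it and failed).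
-/

-- `Summit.<Summit>.<Problem>`: for the single-conjunct summit the duplicate component is mandated.
set_option linter.dupNamespace false

namespace Summit.MatrixMultiplication.MatrixMultiplication.Cruxes.ExteriorExponentOne.Birth

open Literature.Computability.AlgebraicComplexity
open Summit.MatrixMultiplication.MatrixMultiplication.Theses.HenselReesLifting

/-! ## The three registered stubs -/

/-- **Stub 1 — Koszul splitting of `T_{Λ_{k+l}}` at rank level (provable now, size M).** Under the
order-preserving relabelling `Finset (Fin (k+l)) ≃ Finset (Fin k) × Finset (Fin l)`, `S ↦ (S₁, S₂)`
(`S₁` = the part of `S` below `k`, `S₂` = the part from `k` on, shifted down by `k`), the exterior tensor of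
rank `k + l` becomes the Kronecker product of `T_{Λ_k}` and `T_{Λ_l}` twisted by the Koszul sign
`(−1)^{|S₂|·|T₁|}`: `Disjoint S T ∧ U = S ∪ T` splits blockwise and
`inv(S,T) = inv(S₁,T₁) + inv(S₂,T₂) + |S₂|·|T₁|`. Ranks agree by `tensorRank_reindex` (tree). Stated as the
rank EQUALITY it yields; true over every commutative ring. Why plausibly true: it is a computation
(`crossInversions_eq_sum_left/right`, `Finset.filter` over the two blocks). Sources: arXiv:1804.09448 §2.1
(sign of `e_I ∧ e_J`), Artin, Geometric Algebra Ch. V §4 (`∏ (s,t)`), `Literature/…/ExteriorTensor.lean`. -/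
theorem stub_exteriorSplitting :
    ∀ (K : Type) [CommRing K] (k l : ℕ),
      tensorRank (exteriorTensor K (k + l)) =
        tensorRank (fun (U S T : Finset (Fin k) × Finset (Fin l)) =>
          exteriorTensor K k U.1 S.1 T.1 * exteriorTensor K l U.2 S.2 T.2 *
            (-1 : K) ^ (S.2.card * T.1.card)) := by
  sorry

/-- **Stub 2 — rank of a parity-twisted Kronecker product (provable now, size M).** For tensors `A` on
`ι × κ × μ` and `B` on `ι' × κ' × μ'` over a commutative ring and weights `σ : κ' → ℕ`, `τ : μ → ℕ`, the
Kronecker product twisted by the bicharacter `(−1)^{σ(b')·τ(c)}` of ONE leg of each factor has rank at most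
`2·R(A)·R(B)`: write `A = ∑_{i<r} wᵢ ⊗ xᵢ ⊗ vᵢ`, `B = ∑_{j<r'} w'ⱼ ⊗ x'ⱼ ⊗ v'ⱼ`, split
`vᵢ = vᵢ⁰ + vᵢ¹` by the parity of `τ`, and use
`(−1)^{σ(b')τ(c)} vᵢᵖ(c) = ((−1)^{p·σ(b')}) vᵢᵖ(c)` on the support of `vᵢᵖ`; the `2rr'` triads
`(wᵢ ⊗ w'ⱼ) ⊗ (xᵢ ⊗ (−1)^{pσ}x'ⱼ) ⊗ (vᵢᵖ ⊗ v'ⱼ)` sum to the twisted product. Why plausibly true: it is this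
two-line computation (in Lean: `exists_triad_decomposition_tensorRank`, `tensorRank_le_card_of_eq_sum` over
`Fin r × Fin r' × Fin 2`, `Finset.sum` bookkeeping). The factor `2` is the price of the `ℤ/2`-grading; the
same lemma with the rôles of the legs permuted serves `Cl_{k+l} = Cl_k ⊗̂ Cl_l`. Sources: folklore
(super / graded tensor products, Koszul sign rule); BurgisserClausenShokrollahi1997 (14.23) for `R(A ⊗ B) ≤
R(A)R(B)`, of which this is the `ℤ/2`-twisted variant. -/
theorem stub_twistedKroneckerRank :
    ∀ (K : Type) [CommRing K] (ι κ μ ι' κ' μ' : Type) [Fintype ι] [Fintype κ] [Fintype μ]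
      [Fintype ι'] [Fintype κ'] [Fintype μ'] (A : ι → κ → μ → K) (B : ι' → κ' → μ' → K)
      (σ : κ' → ℕ) (τ : μ → ℕ),
      tensorRank (fun (a : ι × ι') (b : κ × κ') (c : μ × μ') =>
          A a.1 b.1 c.1 * B a.2 b.2 c.2 * (-1 : K) ^ (σ b.2 * τ c.1)) ≤
        2 * tensorRank A * tensorRank B := by
  sorry

/-- **Stub 3 — finite exterior designs (OPEN; the load-bearing transfer stub).** For every `δ > 0` there is
ONE block size `k ≥ 1` whose exterior tensor has `2·R(T_{Λ_k}) ≤ 2^((1+δ)k)` over `ℂ`. Transfer `C⁺` of the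
crux to a finitary statement (one explicit `0, ±1` tensor of format `2^k` per `δ`), exposed to computer
search + exact reconstruction, to the route's 2-adic lifting at a single finite level
(`finiteExteriorDesign_of_twoAdic` below), and to explicit graded constructions. Frame:
`2·2^k − 1 ≤ R(T_{Λ_k})` (Alder–Strassen, tree fact `AlderStrassen1981_rank`; forces `δk ≥ 2`),
`R(T_{Λ_k}) ≤ 3^k` trivially, `≤ 2^((ω/2)k + o(k))` via `Λ_k = gr Cl_k`. Why it might fail: the rank
exponent `e_R = lim log₂R(T_{Λ_k})/k` could exceed `1` (the fermionic sign costing a fixed exponent, up to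
`e_R = ω/2`); by graded sub-multiplicativity `e_R = e_Λ`, so this fails exactly if the crux fails. Size:
open problem. Sources: arXiv:1804.09448 p. 7 (no bound below `2^{ωk/2}` known for one wedge product),
arXiv:1609.07134, arXiv:2212.01175 (search + Hensel lifting of finite schemes), BlaserLysikov2016. -/
theorem stub_finiteExteriorDesign :
    ∀ δ : ℝ, 0 < δ → ∃ k : ℕ, 1 ≤ k ∧
      2 * (tensorRank (exteriorTensor ℂ k) : ℝ) ≤ (2 : ℝ) ^ ((1 + δ) * k) := by
  sorry

/-! ## Sorry-free compositions -/

/-- **Graded sub-multiplicativity with defect `2`** from stubs 1–2 (explicit hypotheses):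
`R(T_{Λ_{k+l}}) ≤ 2·R(T_{Λ_k})·R(T_{Λ_l})` over every commutative ring. [folklore] -/
theorem gradedSubmultiplicativity_of_stubs
    (h1 : ∀ (K : Type) [CommRing K] (k l : ℕ),
      tensorRank (exteriorTensor K (k + l)) =
        tensorRank (fun (U S T : Finset (Fin k) × Finset (Fin l)) =>
          exteriorTensor K k U.1 S.1 T.1 * exteriorTensor K l U.2 S.2 T.2 *
            (-1 : K) ^ (S.2.card * T.1.card)))
    (h2 : ∀ (K : Type) [CommRing K] (ι κ μ ι' κ' μ' : Type) [Fintype ι] [Fintype κ] [Fintype μ]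
      [Fintype ι'] [Fintype κ'] [Fintype μ'] (A : ι → κ → μ → K) (B : ι' → κ' → μ' → K)
      (σ : κ' → ℕ) (τ : μ → ℕ),
      tensorRank (fun (a : ι × ι') (b : κ × κ') (c : μ × μ') =>
          A a.1 b.1 c.1 * B a.2 b.2 c.2 * (-1 : K) ^ (σ b.2 * τ c.1)) ≤
        2 * tensorRank A * tensorRank B) :
    ∀ (K : Type) [CommRing K] (k l : ℕ),
      tensorRank (exteriorTensor K (k + l)) ≤
        2 * tensorRank (exteriorTensor K k) * tensorRank (exteriorTensor K l) := by
  intro K _ k l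
  rw [h1 K k l]
  exact h2 K _ _ _ _ _ _ (exteriorTensor K k) (exteriorTensor K l) Finset.card Finset.card

/-- **From sub-multiplicativity and one finite design to the exponent** (explicit hypotheses; the
conclusion is the crux statement over `exteriorTensor ℂ n`). Given `ε > 0`: a design at `δ = ε/2` of block
size `k`; `b_n := 2R(T_{Λ_n})` is sub-multiplicative, so `b_{k(m+1)} ≤ b_k^{m+1}`; for `n ≥ k`, `n = kq + j`
with `q ≥ 1`, `j < k`, `b_n ≤ b_k^q · b_j ≤ 2^((1+ε/2)kq) · 2^(3k+1)` (`R ≤ 8^j`, `tensorRank_le_card`);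
for `n ≥ 6k/ε` the exponent is `≤ (1+ε)n + 1`, so `R(T_{Λ_n}) ≤ 2^((1+ε)n)`, and `R̃ ≤ R`
(`asymptoticRank_le_tensorRank`). Sorry-free, standard axioms. [folklore] -/
theorem ExteriorExponentOne_of_submultiplicative
    (h1 : ∀ (K : Type) [CommRing K] (k l : ℕ),
      tensorRank (exteriorTensor K (k + l)) ≤
        2 * tensorRank (exteriorTensor K k) * tensorRank (exteriorTensor K l))
    (h2 : ∀ δ : ℝ, 0 < δ → ∃ k : ℕ, 1 ≤ k ∧
      2 * (tensorRank (exteriorTensor ℂ k) : ℝ) ≤ (2 : ℝ) ^ ((1 + δ) * k)) :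
    ∀ ε : ℝ, 0 < ε → ∀ᶠ n : ℕ in Filter.atTop,
      asymptoticRank (exteriorTensor ℂ n) ≤ (2 : ℝ) ^ ((1 + ε) * n) := by
  intro ε hε
  -- a finite design at `δ = ε / 2`, of block size `k ≥ 1`
  obtain ⟨k, hk, hdes⟩ := h2 (ε / 2) (half_pos hε)
  -- `b n := 2·R(T_{Λ_n})` is sub-multiplicative in `n`
  have hb : ∀ m l : ℕ, 2 * tensorRank (exteriorTensor ℂ (m + l)) ≤
      (2 * tensorRank (exteriorTensor ℂ m)) * (2 * tensorRank (exteriorTensor ℂ l)) := by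
    intro m l
    calc 2 * tensorRank (exteriorTensor ℂ (m + l))
        ≤ 2 * (2 * tensorRank (exteriorTensor ℂ m) * tensorRank (exteriorTensor ℂ l)) :=
          Nat.mul_le_mul_left 2 (h1 ℂ m l)
      _ = (2 * tensorRank (exteriorTensor ℂ m)) * (2 * tensorRank (exteriorTensor ℂ l)) := by ring
  -- hence `b (k(m+1)) ≤ (b k)^(m+1)`
  have hpow : ∀ m : ℕ, 2 * tensorRank (exteriorTensor ℂ (k * (m + 1))) ≤
      (2 * tensorRank (exteriorTensor ℂ k)) ^ (m + 1) := by
    intro m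
    induction m with
    | zero => rw [Nat.zero_add, Nat.mul_one, pow_one]
    | succ m ih =>
      have e : k * (m + 1 + 1) = k * (m + 1) + k := by ring
      rw [e, pow_succ]
      exact (hb _ _).trans (Nat.mul_le_mul_right _ ih)
  -- small remainders: `b j ≤ 2^(3j+1)` (every tensor of format `2^j` has rank `≤ 8^j`)
  have hsmall : ∀ j : ℕ, 2 * tensorRank (exteriorTensor ℂ j) ≤ 2 ^ (3 * j + 1) := by
    intro j
    have h := tensorRank_le_card (exteriorTensor ℂ j)
    rw [Fintype.card_finset, Fintype.card_fin] at h
    calc 2 * tensorRank (exteriorTensor ℂ j) ≤ 2 * (2 ^ j * 2 ^ j * 2 ^ j) := Nat.mul_le_mul_left 2 h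
      _ = 2 ^ (3 * j + 1) := by ring
  -- eventually: `n ≥ k` and `ε·n ≥ 6k`
  refine Filter.eventually_atTop.2 ⟨max k (Nat.ceil (6 * (k : ℝ) / ε)), fun n hn => ?_⟩
  have hkn : k ≤ n := le_of_max_le_left hn
  have hn6 : 6 * (k : ℝ) / ε ≤ n := Nat.ceil_le.1 (le_of_max_le_right hn)
  have h6 : 6 * (k : ℝ) ≤ n * ε := (div_le_iff₀ hε).1 hn6
  -- Euclidean division `n = k·q + j`, `q ≥ 1`, `j < k`
  have hnkq : k * (n / k) + n % k = n := Nat.div_add_mod n k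
  have hq1 : 1 ≤ n / k := Nat.div_pos hkn hk
  have hjk : n % k < k := Nat.mod_lt n hk
  obtain ⟨q', hq'⟩ : ∃ q' : ℕ, n / k = q' + 1 := ⟨n / k - 1, by omega⟩
  -- the natural-number bound `b n ≤ (b k)^q · 2^(3k+1)`
  have hnat : 2 * tensorRank (exteriorTensor ℂ n) ≤
      (2 * tensorRank (exteriorTensor ℂ k)) ^ (n / k) * 2 ^ (3 * k + 1) := by
    calc 2 * tensorRank (exteriorTensor ℂ n)
        = 2 * tensorRank (exteriorTensor ℂ (k * (n / k) + n % k)) := by rw [hnkq]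
      _ ≤ (2 * tensorRank (exteriorTensor ℂ (k * (n / k)))) * (2 * tensorRank (exteriorTensor ℂ (n % k))) :=
          hb _ _
      _ ≤ (2 * tensorRank (exteriorTensor ℂ k)) ^ (n / k) * 2 ^ (3 * (n % k) + 1) :=
          Nat.mul_le_mul (by rw [hq']; exact hpow q') (hsmall _)
      _ ≤ (2 * tensorRank (exteriorTensor ℂ k)) ^ (n / k) * 2 ^ (3 * k + 1) :=
          Nat.mul_le_mul_left _ (Nat.pow_le_pow_right (by norm_num) (by omega))
  -- pass to `ℝ`: `b n ≤ 2^((1+ε/2)·k·q + (3k+1))`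
  have hkq : (k : ℝ) * (n / k : ℕ) ≤ n := by
    exact_mod_cast (le_of_add_le_left (le_of_eq hnkq) : k * (n / k) ≤ n)
  have hcast : ((2 : ℝ) * tensorRank (exteriorTensor ℂ n)) ≤
      ((2 : ℝ) * tensorRank (exteriorTensor ℂ k)) ^ (n / k) * (2 : ℝ) ^ (3 * k + 1) := by
    exact_mod_cast hnat
  have h0 : (0 : ℝ) ≤ 2 * tensorRank (exteriorTensor ℂ k) := by positivity
  have hpq : ((2 : ℝ) * tensorRank (exteriorTensor ℂ k)) ^ (n / k) ≤
      ((2 : ℝ) ^ ((1 + ε / 2) * k)) ^ (n / k) := pow_le_pow_left₀ h0 hdes (n / k)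
  have e3 : ((3 * k + 1 : ℕ) : ℝ) = 3 * (k : ℝ) + 1 := by push_cast; ring
  have hreal : (2 : ℝ) * tensorRank (exteriorTensor ℂ n) ≤
      (2 : ℝ) ^ ((1 + ε / 2) * k * (n / k : ℕ) + (3 * (k : ℝ) + 1)) := by
    calc (2 : ℝ) * tensorRank (exteriorTensor ℂ n)
        ≤ ((2 : ℝ) * tensorRank (exteriorTensor ℂ k)) ^ (n / k) * (2 : ℝ) ^ (3 * k + 1) := hcast
      _ ≤ ((2 : ℝ) ^ ((1 + ε / 2) * k)) ^ (n / k) * (2 : ℝ) ^ (3 * k + 1) := by gcongr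
      _ = (2 : ℝ) ^ ((1 + ε / 2) * k * (n / k : ℕ) + (3 * (k : ℝ) + 1)) := by
          rw [Real.rpow_add (by norm_num : (0 : ℝ) < 2),
            Real.rpow_mul (by norm_num : (0 : ℝ) ≤ 2) ((1 + ε / 2) * k) ((n / k : ℕ) : ℝ),
            Real.rpow_natCast, ← e3, Real.rpow_natCast]
  -- compare exponents: `(1+ε/2)·k·q + 3k + 1 ≤ (1+ε)·n + 1`
  have hexp : (1 + ε / 2) * k * (n / k : ℕ) + (3 * (k : ℝ) + 1) ≤ (1 + ε) * n + 1 := by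
    have hkq' : (1 + ε / 2) * ((k : ℝ) * (n / k : ℕ)) ≤ (1 + ε / 2) * n :=
      mul_le_mul_of_nonneg_left hkq (by positivity)
    nlinarith [hkq', h6, hε]
  have hfin : (2 : ℝ) * tensorRank (exteriorTensor ℂ n) ≤ 2 * (2 : ℝ) ^ ((1 + ε) * n) := by
    calc (2 : ℝ) * tensorRank (exteriorTensor ℂ n)
        ≤ (2 : ℝ) ^ ((1 + ε / 2) * k * (n / k : ℕ) + (3 * (k : ℝ) + 1)) := hreal
      _ ≤ (2 : ℝ) ^ ((1 + ε) * n + 1) := Real.rpow_le_rpow_of_exponent_le (by norm_num) hexp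
      _ = 2 * (2 : ℝ) ^ ((1 + ε) * n) := by
          rw [Real.rpow_add (by norm_num : (0 : ℝ) < 2), Real.rpow_one, mul_comm]
  have hR : (tensorRank (exteriorTensor ℂ n) : ℝ) ≤ (2 : ℝ) ^ ((1 + ε) * n) :=
    le_of_mul_le_mul_left hfin (by norm_num)
  exact (asymptoticRank_le_tensorRank _).trans hR

/-- **Composition with explicit hypotheses** (the BC3 shape `stub₁-sig → stub₂-sig → stub₃-sig → crux`; the
conclusion is the crux statement with the route's inlined lambda named `exteriorTensor ℂ n`, definitionally
equal by `exteriorTensor_eq`). Sorry-free, standard axioms. [folklore] -/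
theorem ExteriorExponentOne_of_stubs
    (h1 : ∀ (K : Type) [CommRing K] (k l : ℕ),
      tensorRank (exteriorTensor K (k + l)) =
        tensorRank (fun (U S T : Finset (Fin k) × Finset (Fin l)) =>
          exteriorTensor K k U.1 S.1 T.1 * exteriorTensor K l U.2 S.2 T.2 *
            (-1 : K) ^ (S.2.card * T.1.card)))
    (h2 : ∀ (K : Type) [CommRing K] (ι κ μ ι' κ' μ' : Type) [Fintype ι] [Fintype κ] [Fintype μ]
      [Fintype ι'] [Fintype κ'] [Fintype μ'] (A : ι → κ → μ → K) (B : ι' → κ' → μ' → K)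
      (σ : κ' → ℕ) (τ : μ → ℕ),
      tensorRank (fun (a : ι × ι') (b : κ × κ') (c : μ × μ') =>
          A a.1 b.1 c.1 * B a.2 b.2 c.2 * (-1 : K) ^ (σ b.2 * τ c.1)) ≤
        2 * tensorRank A * tensorRank B)
    (h3 : ∀ δ : ℝ, 0 < δ → ∃ k : ℕ, 1 ≤ k ∧
      2 * (tensorRank (exteriorTensor ℂ k) : ℝ) ≤ (2 : ℝ) ^ ((1 + δ) * k)) :
    ∀ ε : ℝ, 0 < ε → ∀ᶠ n : ℕ in Filter.atTop,
      asymptoticRank (exteriorTensor ℂ n) ≤ (2 : ℝ) ^ ((1 + ε) * n) :=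
  ExteriorExponentOne_of_submultiplicative (gradedSubmultiplicativity_of_stubs h1 h2) h3

/-! ## The skeleton theorem: the crux BY NAME -/

/-- **THE SKELETON THEOREM.** The crux
`Summit.MatrixMultiplication.MatrixMultiplication.Theses.HenselReesLifting.ExteriorExponentOne`
(stmt-MatrixMultiplication-3850, `e_Λ = 1`), concluded BY NAME from the three DECLARED stubs
`stub_exteriorSplitting`, `stub_twistedKroneckerRank`, `stub_finiteExteriorDesign` (the only `sorry`s of the
file) through the sorry-free composition `ExteriorExponentOne_of_stubs` (the route's inlined lambda is
`exteriorTensor ℂ n` by `rfl`). [cite: BrandDellHusfeldt2018, §2.1] -/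
theorem ExteriorExponentOne_of :
    Summit.MatrixMultiplication.MatrixMultiplication.Theses.HenselReesLifting.ExteriorExponentOne :=
  ExteriorExponentOne_of_stubs stub_exteriorSplitting stub_twistedKroneckerRank stub_finiteExteriorDesign

/-! ## Kernel-checked remark: how the route's 2-adic mechanism feeds stub 3 -/

/-- `T_{Λ_n}` has entries `0, ±1` (`exteriorTensor_map`), so along any ring homomorphism `K → L` its rank
over `L` is at most its rank over `K` (`tensorRank_map_le`, Bläser 1999 §5 (10)). [cite: Blaser1999, §5 eq. (10)] -/
theorem tensorRank_exteriorTensor_map_le {K L : Type*} [CommRing K] [CommRing L] (f : K →+* L) (n : ℕ) :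
    tensorRank (exteriorTensor L n) ≤ tensorRank (exteriorTensor K n) := by
  rw [← exteriorTensor_map f n]
  exact tensorRank_map_le f _

/-- **A 2-adically integral finite design gives stub 3.** A decomposition of ONE `T_{Λ_k}` over the
valuation ring `Z̄_2` of `Q̄_2 = PadicAlgCl 2` (as in the route's crux `HenselLiftExterior`, but at a single
finite level and without Kronecker powers — its reduction mod the maximal ideal is an `F̄_2`-decomposition of
`T_{D_k} = T_{Λ_k} ⊗ F_2`, `exteriorTensor_zmod_two`) transports to `ℂ` along `Z̄_2 ⊂ Q̄_2 ≃+* ℂ`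
(`PadicAlgCl.nonempty_ringEquiv_complex`, Steinitz). [folklore] -/
theorem finiteExteriorDesign_of_twoAdic
    (h : ∀ δ : ℝ, 0 < δ → ∃ k : ℕ, 1 ≤ k ∧
      2 * (tensorRank (exteriorTensor (PadicAlgCl.valued 2).v.integer k) : ℝ) ≤ (2 : ℝ) ^ ((1 + δ) * k)) :
    ∀ δ : ℝ, 0 < δ → ∃ k : ℕ, 1 ≤ k ∧
      2 * (tensorRank (exteriorTensor ℂ k) : ℝ) ≤ (2 : ℝ) ^ ((1 + δ) * k) := by
  intro δ hδ
  obtain ⟨k, hk, hle⟩ := h δ hδ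
  obtain ⟨e⟩ := PadicAlgCl.nonempty_ringEquiv_complex 2
  refine ⟨k, hk, le_trans ?_ hle⟩
  have hmap := tensorRank_exteriorTensor_map_le
    (e.toRingHom.comp (Subring.subtype (PadicAlgCl.valued 2).v.integer)) k
  exact_mod_cast Nat.mul_le_mul_left 2 hmap

end Summit.MatrixMultiplication.MatrixMultiplication.Cruxes.ExteriorExponentOne.Birth
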